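import Summits.QuantumFields.YangMills.Theorems.BalabanUVNodesN15FullPropagatorMatrixTwoSidedNode
import Summits.QuantumFields.YangMills.Theorems.BalabanUVNodesN15FullPropagatorMatrixPrimitive
import HarnessLib

/-!
# `NE2PlusOperator` BY NAME FOR `gOp ⊗ 1_𝔤` OVER THE TWO-SIDED PRIMITIVE MATRIX CARRIER: entrywise sup letters on `C′`, the forward AND backward coefficient fields `A′_μ`, `B′_μ`, their
# first and second quotients — every two-grid clause of FILE 19's carrier DERIVED (dag-n15-c g9, FILE 22; Track-A node N15 = NE2, s1 «background-layer OPERATOR ingredient»)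

`--kind proof --supports stmt-QuantumFields-20544 --as helper` (K3⁷; count-neutral).  Imports BY NAME FILE 21 `…N15FullPropagatorMatrixTwoSidedNode` (`fgInstanceM₂`, `fgFamilyM₂`,
`ne2PlusOperator_fullGM₂_byParts`; FILE 19 `coeffBgMBP₂` ∕ `bgPairingMBP₂` ∕ `bgOpsMBP₂`) and FILE 17 `…N15FullPropagatorMatrixPrimitive` (`entryCfg`, `avgM₁_snd_entry`; FILE 11 `coeffBgC2` ∕
`reg_slim_of_C2`, FILE 10 `abs_derivFit_le'` ∕ `fibreOsc_of_fgrad` ∕ `abs_fgrad_blockAvg_le` ∕ `abs_sub_le_of_fgrad` ∕ `blockAvg_translate`, FILE 9 `reg_BP_of_slim` ∕ `inv_pow_le_rate`,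
F13 `kingPrV_bshiftEquiv_pow` ∕ `bshiftEquiv_pow_apply`, FILE 4 `kingPrV_add`, W1 `kingPrV_sub`, `fit_blockAvg`); nothing in the tree is modified.

WHAT (the two-sided twin of FILE 17).  §1 lattice Taylor kit II: `abs_sub_pow_le`, `abs_translatedFitFwd_le` (`|f(x′+e′) − f̄(πx′+e)| ≤ o + r∕n`, `kingPrV_add`), ★ `abs_derivFit0_le` (the
UNTRANSLATED derivative fit `|∇′_μf(x′) − ∇_μf̄(πx′)| ≤ (2d+5)r₂∕n`: FILE 10's translated fit for `f∘shift′^{L^m}`, whose block mean is `f̄∘shift`).  §2 the carrier `coeffBgMC2₂`, pairing ∕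
instance ∕ family, torus `fgInstanceMC2₂` ∕ `fgFamilyMC2₂` (NO rate number).  §3 ★ `reg_MBP₂_of_MC2₂` (level `c` ⟹ `coeffBgMBP₂` at `4(2d+3)c`, any `γ ≤ 1`), ★★ `ne2PlusOperator_fullGM₂_C2_of_MBP₂`, ★★★ **`ne2PlusOperator_fullGM₂_C2`** (HYPOTHESIS-FREE; rate exponent PRODUCED), `_dim4`.

HONEST FRAMING.  Operator layer for the GENUINE `U ≡ 1` propagator `gOp ⊗ 1_𝔤` and a LIVE two-sided matrix-coefficient first-order background — the SHAPE of (3.52) `V′₁(A) = M_c +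
Σ_μ[M_{a⁺_μ}∇_μ + M_{a⁻_μ}∇⁻_μ]` in coordinates — whose hypotheses are ENTRYWISE sup letters on the coefficient fields and their first ∕ second quotients (the (3.35)–(3.36) shape, one uniform
constant).  MODEL-LEVEL still: the coefficient matrices are FREE data (not yet `ad`-polynomials of ONE gauge field), entrywise-linearised (C3) transport.  NE2⁺ as printed NOT PRINTED, NOT
proved, not claimed; count-neutral (typed 28∕28 · discharged 5∕27 of record unchanged); N15 NOT discharged; one finite T⁴ at fixed ε — NOT ℝ⁴, NOT infinite volume, NOT OS, NOT a mass
gap, NOT Clay.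
-/


noncomputable section

open scoped BigOperators
open Finset

namespace Summit.QuantumFields.YangMills.BalabanUVNodes.N15.BackgroundLayer

open Literature.MathematicalPhysics.QuantumFieldTheory.Balaban1983to89
open Literature.MathematicalPhysics.QuantumFieldTheory.Balaban1983to89.T4EtaRate (PairedInstance EtaPairing EtaRateIneq342 NE2PlusOperator)
open Literature.MathematicalPhysics.QuantumFieldTheory.Balaban1983to89.T4EtaRateCoeffDefect (pull FibreOsc blockAvg fit_blockAvg)
open Literature.MathematicalPhysics.QuantumFieldTheory.Balaban1983to89.B5Prop11Plancherel (Tor fine unitVec)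
open Literature.MathematicalPhysics.QuantumFieldTheory.Balaban1983to89.B5SiteBridgeP12 (MP)
open Literature.MathematicalPhysics.QuantumFieldTheory.Balaban1983to89.B6UnitTorusCarrier (unitTorusGeo)
open Summit.QuantumFields.YangMills.BalabanUVNodes.N15.OperatorReadout (opGeo opFamily)
open Summit.QuantumFields.YangMills.BalabanUVNodes.N15.MatrixSpecies (liftMap liftBlk liftEquiv)
open Summit.QuantumFields.YangMills.BalabanUVNodes.N15.TwoGrid (gOp symbOp sLap TGIndex TGIndex.Mn)
open Summit.QuantumFields.YangMills.BalabanUVNodes.N15.VectorPiece (blkFine kingPrV kingPrV_sub bshiftEquiv bshiftEquiv_apply bshiftEquiv_symm_apply bshiftEquiv_pow_apply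
  kingPrV_bshiftEquiv_pow tensorId)

variable {d : ℕ}

/-! ## §1 Lattice Taylor kit, part II: telescoping, the forward-translated fit, the untranslated derivative fit -/

section Taylor

variable {X' : Type}

/-- telescoping along `e^N`: `|F(e^N z) − F(z)| ≤ N·β` from the one-step bound `|F(e z) − F(z)| ≤ β`. [folklore] -/
theorem abs_sub_pow_le (e : X' ≃ X') {F : X' → ℝ} {β : ℝ} (h : ∀ z, |F (e z) - F z| ≤ β) : ∀ (N : ℕ) (z : X'), |F ((e ^ N) z) - F z| ≤ N * β := by
  intro N
  induction N with
  | zero => intro z; simp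
  | succ N ih =>
      intro z
      rw [pow_succ', Equiv.Perm.mul_apply]
      calc |F (e ((e ^ N) z)) - F z| ≤ |F (e ((e ^ N) z)) - F ((e ^ N) z)| + |F ((e ^ N) z) - F z| := abs_sub_le _ _ _
        _ ≤ β + N * β := add_le_add (h _) (ih z)
        _ = (N + 1 : ℕ) * β := by push_cast; ring

variable (L k m : ℕ) [NeZero L] (M : Fin (d + 1) → ℕ) [∀ μ, NeZero (M μ)]

/-- **THE FORWARD-TRANSLATED FIT** `|f(x′ + e′_μ) − f̄(πx′ + e_μ)| ≤ o + r∕n` from the block oscillation `o` of `f` and its coarse gradient letter `|∇_μf̄| ≤ r` (`n = L^k`): the block of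
`x′ + e′_μ` is the block of `x′` or its `μ`-successor (FILE 4 `kingPrV_add`). [folklore] -/
theorem abs_translatedFitFwd_le (μ : Fin (d + 1)) {f : Tor (fine (L ^ m * L ^ k) M) × Fin (d + 1) → ℝ} {o r : ℝ} (hr : 0 ≤ r)
    (hosc : FibreOsc (kingPrV L k m M) f (fun _ => o)) (hgrad : ∀ x, |fgrad ((L ^ k : ℕ) : ℝ) (bshiftEquiv M (L ^ k) μ) (blockAvg (kingPrV L k m M) f) x| ≤ r)
    (x' : Tor (fine (L ^ m * L ^ k) M) × Fin (d + 1)) :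
    |f (bshiftEquiv M (L ^ m * L ^ k) μ x') - blockAvg (kingPrV L k m M) f (bshiftEquiv M (L ^ k) μ (kingPrV L k m M x'))| ≤ o + r / ((L ^ k : ℕ) : ℝ) := by
  have hL0 : 0 < L := Nat.pos_of_ne_zero (NeZero.ne L)
  have hn : (0 : ℝ) < ((L ^ k : ℕ) : ℝ) := by positivity
  have hfit := fit_blockAvg (kingPrV L k m M) hosc (bshiftEquiv M (L ^ m * L ^ k) μ x')
  have ho : 0 ≤ o := (abs_nonneg _).trans hfit
  have hstep := abs_sub_le_of_fgrad hn (bshiftEquiv M (L ^ k) μ) hgrad (kingPrV L k m M x')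
  rw [bshiftEquiv_apply] at hfit ⊢
  rcases kingPrV_add M k m x' μ with h | h
  · rw [h] at hfit
    calc |f (x'.1 + unitVec (fine (L ^ m * L ^ k) M) μ, x'.2) - blockAvg (kingPrV L k m M) f (bshiftEquiv M (L ^ k) μ (kingPrV L k m M x'))|
        ≤ |f (x'.1 + unitVec (fine (L ^ m * L ^ k) M) μ, x'.2) - blockAvg (kingPrV L k m M) f (kingPrV L k m M x')| +
          |blockAvg (kingPrV L k m M) f (kingPrV L k m M x') - blockAvg (kingPrV L k m M) f (bshiftEquiv M (L ^ k) μ (kingPrV L k m M x'))| := abs_sub_le _ _ _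
      _ ≤ o + r / ((L ^ k : ℕ) : ℝ) := add_le_add hfit (by rw [abs_sub_comm]; exact hstep)
  · rw [h, ← bshiftEquiv_apply] at hfit
    exact hfit.trans (le_add_of_nonneg_right (by positivity))

/-- ★ **THE UNTRANSLATED DERIVATIVE FIT** `|∇′_μf(x′) − ∇_μf̄(πx′)| ≤ (2d+5)·r₂∕n` from the second quotients `|∇′_κ∇′_μf| ≤ r₂` (all `κ`; `n = L^k`, `n′ = L^mL^k`): FILE 10's translated fit
`abs_derivFit_le'` applied to `g = f∘shift′^{L^m}` — whose block mean is `f̄∘shift` (block-translation law `kingPrV_bshiftEquiv_pow` + `blockAvg_translate`), so that its translated coarse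
quotient at `πx′ − e` IS the untranslated one of `f` at `πx′` — plus `L^m + 1` one-step telescopings of `∇′_μf`. [folklore] -/
theorem abs_derivFit0_le {r₂ : ℝ} (hr₂ : 0 ≤ r₂) (μ : Fin (d + 1)) {f : Tor (fine (L ^ m * L ^ k) M) × Fin (d + 1) → ℝ}
    (h2 : ∀ κ z, |fgrad ((L ^ m * L ^ k : ℕ) : ℝ) (bshiftEquiv M (L ^ m * L ^ k) κ)
      (fgrad ((L ^ m * L ^ k : ℕ) : ℝ) (bshiftEquiv M (L ^ m * L ^ k) μ) f) z| ≤ r₂) (x' : Tor (fine (L ^ m * L ^ k) M) × Fin (d + 1)) :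
    |fgrad ((L ^ m * L ^ k : ℕ) : ℝ) (bshiftEquiv M (L ^ m * L ^ k) μ) f x' - fgrad ((L ^ k : ℕ) : ℝ) (bshiftEquiv M (L ^ k) μ) (blockAvg (kingPrV L k m M) f) (kingPrV L k m M x')| ≤
      (2 * (d : ℝ) + 5) * r₂ / ((L ^ k : ℕ) : ℝ) := by
  have hL0 : 0 < L := Nat.pos_of_ne_zero (NeZero.ne L)
  have hnc : (0 : ℝ) < ((L ^ k : ℕ) : ℝ) := by positivity
  have hnf : (0 : ℝ) < ((L ^ m * L ^ k : ℕ) : ℝ) := by positivity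
  have hnfc : ((L ^ m * L ^ k : ℕ) : ℝ) = ((L ^ m : ℕ) : ℝ) * ((L ^ k : ℕ) : ℝ) := by push_cast; ring
  have hLm1 : (1 : ℝ) ≤ ((L ^ m : ℕ) : ℝ) := by exact_mod_cast Nat.one_le_pow _ _ hL0
  -- the shifted function and its commuting data
  have hcomm : ∀ ν w, (bshiftEquiv M (L ^ m * L ^ k) μ ^ L ^ m) (bshiftEquiv M (L ^ m * L ^ k) ν w) =
      bshiftEquiv M (L ^ m * L ^ k) ν ((bshiftEquiv M (L ^ m * L ^ k) μ ^ L ^ m) w) := fun ν w => by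
    rw [bshiftEquiv_pow_apply, bshiftEquiv_pow_apply, bshiftEquiv_apply, bshiftEquiv_apply]
    exact Prod.ext (add_right_comm _ _ _) rfl
  set g : Tor (fine (L ^ m * L ^ k) M) × Fin (d + 1) → ℝ := fun z => f ((bshiftEquiv M (L ^ m * L ^ k) μ ^ L ^ m) z) with hg
  have hg2 : ∀ κ z, |fgrad ((L ^ m * L ^ k : ℕ) : ℝ) (bshiftEquiv M (L ^ m * L ^ k) κ) (fgrad ((L ^ m * L ^ k : ℕ) : ℝ) (bshiftEquiv M (L ^ m * L ^ k) μ) g) z| ≤ r₂ := by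
    intro κ z
    have heq : fgrad ((L ^ m * L ^ k : ℕ) : ℝ) (bshiftEquiv M (L ^ m * L ^ k) κ) (fgrad ((L ^ m * L ^ k : ℕ) : ℝ) (bshiftEquiv M (L ^ m * L ^ k) μ) g) z =
        fgrad ((L ^ m * L ^ k : ℕ) : ℝ) (bshiftEquiv M (L ^ m * L ^ k) κ) (fgrad ((L ^ m * L ^ k : ℕ) : ℝ) (bshiftEquiv M (L ^ m * L ^ k) μ) f)
          ((bshiftEquiv M (L ^ m * L ^ k) μ ^ L ^ m) z) := by
      simp only [fgrad_apply, hg, hcomm]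
    rw [heq]; exact h2 κ _
  -- the block mean of the shifted function is the shifted block mean
  have hblk : ∀ z, kingPrV L k m M ((bshiftEquiv M (L ^ m * L ^ k) μ ^ L ^ m).symm z) = (bshiftEquiv M (L ^ k) μ).symm (kingPrV L k m M z) := fun z => by
    have h1 := kingPrV_bshiftEquiv_pow L k m M μ ((bshiftEquiv M (L ^ m * L ^ k) μ ^ L ^ m).symm z)
    rw [Equiv.apply_symm_apply] at h1
    rw [h1, Equiv.symm_apply_apply]
  have hgbar : ∀ y, blockAvg (kingPrV L k m M) g y = blockAvg (kingPrV L k m M) f (bshiftEquiv M (L ^ k) μ y) := fun y => by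
    have h1 := blockAvg_translate (kingPrV L k m M) (bshiftEquiv M (L ^ m * L ^ k) μ ^ L ^ m).symm (bshiftEquiv M (L ^ k) μ).symm hblk f y
    simp only [Equiv.symm_symm] at h1
    rw [hg]; exact h1.symm
  -- FILE 10's translated fit for `g`, read back for `f`
  have hfit := abs_derivFit_le' L k m M hr₂ μ hg2 x'
  have hcoarse : fgrad ((L ^ k : ℕ) : ℝ) (bshiftEquiv M (L ^ k) μ) (blockAvg (kingPrV L k m M) g) ((bshiftEquiv M (L ^ k) μ).symm (kingPrV L k m M x')) =
      fgrad ((L ^ k : ℕ) : ℝ) (bshiftEquiv M (L ^ k) μ) (blockAvg (kingPrV L k m M) f) (kingPrV L k m M x') := by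
    rw [fgrad_apply, fgrad_apply, hgbar, hgbar, Equiv.apply_symm_apply]
  have hfine : fgrad ((L ^ m * L ^ k : ℕ) : ℝ) (bshiftEquiv M (L ^ m * L ^ k) μ) g ((bshiftEquiv M (L ^ m * L ^ k) μ).symm x') =
      fgrad ((L ^ m * L ^ k : ℕ) : ℝ) (bshiftEquiv M (L ^ m * L ^ k) μ) f ((bshiftEquiv M (L ^ m * L ^ k) μ ^ L ^ m) ((bshiftEquiv M (L ^ m * L ^ k) μ).symm x')) := by
    simp only [fgrad_apply, hg, hcomm]
  rw [hcoarse, hfine] at hfit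
  -- `L^m + 1` one-step telescopings of `∇′_μf`
  have hone := abs_sub_le_of_fgrad hnf (bshiftEquiv M (L ^ m * L ^ k) μ) (h2 μ)
  have htel := abs_sub_pow_le (bshiftEquiv M (L ^ m * L ^ k) μ) hone (L ^ m) ((bshiftEquiv M (L ^ m * L ^ k) μ).symm x')
  have hx : fgrad ((L ^ m * L ^ k : ℕ) : ℝ) (bshiftEquiv M (L ^ m * L ^ k) μ) f x' =
      fgrad ((L ^ m * L ^ k : ℕ) : ℝ) (bshiftEquiv M (L ^ m * L ^ k) μ) f (bshiftEquiv M (L ^ m * L ^ k) μ ((bshiftEquiv M (L ^ m * L ^ k) μ).symm x')) := by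
    rw [Equiv.apply_symm_apply]
  have hone' := hone ((bshiftEquiv M (L ^ m * L ^ k) μ).symm x')
  have hA : |fgrad ((L ^ m * L ^ k : ℕ) : ℝ) (bshiftEquiv M (L ^ m * L ^ k) μ) f x' -
      fgrad ((L ^ m * L ^ k : ℕ) : ℝ) (bshiftEquiv M (L ^ m * L ^ k) μ) f ((bshiftEquiv M (L ^ m * L ^ k) μ ^ L ^ m) ((bshiftEquiv M (L ^ m * L ^ k) μ).symm x'))| ≤
      (((L ^ m : ℕ) : ℝ) + 1) * (r₂ / ((L ^ m * L ^ k : ℕ) : ℝ)) := by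
    rw [hx]
    calc _ ≤ |fgrad ((L ^ m * L ^ k : ℕ) : ℝ) (bshiftEquiv M (L ^ m * L ^ k) μ) f (bshiftEquiv M (L ^ m * L ^ k) μ ((bshiftEquiv M (L ^ m * L ^ k) μ).symm x')) -
            fgrad ((L ^ m * L ^ k : ℕ) : ℝ) (bshiftEquiv M (L ^ m * L ^ k) μ) f ((bshiftEquiv M (L ^ m * L ^ k) μ).symm x')| +
          |fgrad ((L ^ m * L ^ k : ℕ) : ℝ) (bshiftEquiv M (L ^ m * L ^ k) μ) f ((bshiftEquiv M (L ^ m * L ^ k) μ).symm x') -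
            fgrad ((L ^ m * L ^ k : ℕ) : ℝ) (bshiftEquiv M (L ^ m * L ^ k) μ) f ((bshiftEquiv M (L ^ m * L ^ k) μ ^ L ^ m) ((bshiftEquiv M (L ^ m * L ^ k) μ).symm x'))| :=
          abs_sub_le _ _ _
      _ ≤ r₂ / ((L ^ m * L ^ k : ℕ) : ℝ) + (L ^ m : ℕ) * (r₂ / ((L ^ m * L ^ k : ℕ) : ℝ)) := add_le_add hone' (by rw [abs_sub_comm]; exact htel)
      _ = (((L ^ m : ℕ) : ℝ) + 1) * (r₂ / ((L ^ m * L ^ k : ℕ) : ℝ)) := by ring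
  have hA' : (((L ^ m : ℕ) : ℝ) + 1) * (r₂ / ((L ^ m * L ^ k : ℕ) : ℝ)) ≤ 2 * r₂ / ((L ^ k : ℕ) : ℝ) := by
    have hLm0 : (0 : ℝ) < ((L ^ m : ℕ) : ℝ) := by positivity
    calc (((L ^ m : ℕ) : ℝ) + 1) * (r₂ / ((L ^ m * L ^ k : ℕ) : ℝ))
        = ((((L ^ m : ℕ) : ℝ) + 1) / ((L ^ m : ℕ) : ℝ)) * (r₂ / ((L ^ k : ℕ) : ℝ)) := by rw [hnfc]; field_simp
      _ ≤ 2 * (r₂ / ((L ^ k : ℕ) : ℝ)) := by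
          refine mul_le_mul_of_nonneg_right ?_ (by positivity)
          rw [div_le_iff₀ hLm0]; linarith
      _ = 2 * r₂ / ((L ^ k : ℕ) : ℝ) := by ring
  calc |fgrad ((L ^ m * L ^ k : ℕ) : ℝ) (bshiftEquiv M (L ^ m * L ^ k) μ) f x' - fgrad ((L ^ k : ℕ) : ℝ) (bshiftEquiv M (L ^ k) μ) (blockAvg (kingPrV L k m M) f) (kingPrV L k m M x')|
      ≤ |fgrad ((L ^ m * L ^ k : ℕ) : ℝ) (bshiftEquiv M (L ^ m * L ^ k) μ) f x' -
            fgrad ((L ^ m * L ^ k : ℕ) : ℝ) (bshiftEquiv M (L ^ m * L ^ k) μ) f ((bshiftEquiv M (L ^ m * L ^ k) μ ^ L ^ m) ((bshiftEquiv M (L ^ m * L ^ k) μ).symm x'))| +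
        |fgrad ((L ^ m * L ^ k : ℕ) : ℝ) (bshiftEquiv M (L ^ m * L ^ k) μ) f ((bshiftEquiv M (L ^ m * L ^ k) μ ^ L ^ m) ((bshiftEquiv M (L ^ m * L ^ k) μ).symm x')) -
            fgrad ((L ^ k : ℕ) : ℝ) (bshiftEquiv M (L ^ k) μ) (blockAvg (kingPrV L k m M) f) (kingPrV L k m M x')| := abs_sub_le _ _ _
    _ ≤ 2 * r₂ / ((L ^ k : ℕ) : ℝ) + (2 * (d : ℝ) + 3) * r₂ / ((L ^ k : ℕ) : ℝ) := add_le_add (hA.trans hA') hfit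
    _ = (2 * (d : ℝ) + 5) * r₂ / ((L ^ k : ℕ) : ℝ) := by ring

end Taylor
/-! ## §2 The two-sided primitive matrix carrier, its pairing, instance, kernel family and torus instance -/

section Carrier

variable {X X' : Type} (J ι : Type) [Fintype ι] [Fintype X'] [DecidableEq X]

/-- THE TWO-SIDED PRIMITIVE (3.35)–(3.36)-SHAPED MATRIX CARRIER of a matrix coefficient family `U = (C′, Â′)`, `Â′ : J ⊕ J → (X′ → Matrix ι ι ℝ)` (forward coefficients on `inl`, backward
on `inr`), on one lattice with bond shifts `τ′_κ` and quotient parameter `n′`: level-`c` regularity = ENTRYWISE `|C′_{ij}|, |Â′_{ĵ,ij}| ≤ cMα₀`, `|∇′_κC′_{ij}|, |∇′_κÂ′_{ĵ,ij}| ≤ cMα₀` (all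
`ĵ ∈ J ⊕ J`, all directions `κ`) and the second quotients `|∇′_κ∇′_μA′_{μ,ij}|, |∇′_κ∇′_μB′_{μ,ij}| ≤ cMα₀`; no complexification clauses.
[cite: Balaban1985BackgroundPropagators, (3.35)–(3.36) p.396 (shape); (3.52) p.400 (the species with `a⁺_μ`, `a⁻_μ`: shape)] -/
def coeffBgMC2₂ (τ' : J → X' ≃ X') (n' M : ℝ) : B9.Backgrounds where
  Cfg := (X' → Matrix ι ι ℝ) × (J ⊕ J → X' → Matrix ι ι ℝ)
  one := 0
  mul := fun U₁ U₂ => U₁ + U₂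
  Reg335 := fun c α₀ U =>
    ((∀ x' i j, |U.1 x' i j| ≤ c * M * α₀) ∧ ∀ μ x' i j, |U.2 μ x' i j| ≤ c * M * α₀) ∧
      ((∀ κ x' i j, |fgrad n' (τ' κ) (fun y => U.1 y i j) x'| ≤ c * M * α₀) ∧ ∀ μ κ x' i j, |fgrad n' (τ' κ) (fun y => U.2 μ y i j) x'| ≤ c * M * α₀) ∧
        ((∀ μ κ x' i j, |fgrad n' (τ' κ) (fgrad n' (τ' μ) (fun y => U.2 (Sum.inl μ) y i j)) x'| ≤ c * M * α₀) ∧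
          ∀ μ κ x' i j, |fgrad n' (τ' κ) (fgrad n' (τ' μ) (fun y => U.2 (Sum.inr μ) y i j)) x'| ≤ c * M * α₀)
  Reg336 := fun c α₀ U =>
    (∀ μ κ x' i j, |fgrad n' (τ' κ) (fgrad n' (τ' μ) (fun y => U.2 (Sum.inl μ) y i j)) x'| ≤ c * M * α₀) ∧
      ∀ μ κ x' i j, |fgrad n' (τ' κ) (fgrad n' (τ' μ) (fun y => U.2 (Sum.inr μ) y i j)) x'| ≤ c * M * α₀
  Cplx337 := fun _ _ _ => True
  Cplx338 := fun _ _ _ => True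

variable {J ι} in
omit [Fintype ι] [Fintype X'] [DecidableEq X] in
/-- two-sided primitive-matrix-regular at level `c` IS primitive-regular at level `c` (FILE 11's `coeffBgC2`) on every entry of the FORWARD family `(C′, A′)` and of the BACKWARD family
`(C′, B′)`. [folklore] -/
theorem entry_reg_C2_of_MC2₂ {τ' : J → X' ≃ X'} {n' M c α₀ : ℝ} {U : (X' → Matrix ι ι ℝ) × (J ⊕ J → X' → Matrix ι ι ℝ)}
    (h : (coeffBgMC2₂ J ι τ' n' M).Reg335 c α₀ U) (i j : ι) :
    (coeffBgC2 J τ' n' M).Reg335 c α₀ (entryCfg J ι (U.1, fun μ => U.2 (Sum.inl μ)) i j) ∧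
      (coeffBgC2 J τ' n' M).Reg335 c α₀ (entryCfg J ι (U.1, fun μ => U.2 (Sum.inr μ)) i j) :=
  ⟨⟨⟨fun x' => h.1.1 x' i j, fun μ x' => h.1.2 (Sum.inl μ) x' i j⟩, ⟨fun κ x' => h.2.1.1 κ x' i j, fun μ κ x' => h.2.1.2 (Sum.inl μ) κ x' i j⟩,
      fun μ κ x' => h.2.2.1 μ κ x' i j⟩,
    ⟨⟨fun x' => h.1.1 x' i j, fun μ x' => h.1.2 (Sum.inr μ) x' i j⟩, ⟨fun κ x' => h.2.1.1 κ x' i j, fun μ κ x' => h.2.1.2 (Sum.inr μ) κ x' i j⟩,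
      fun μ κ x' => h.2.2.2 μ κ x' i j⟩⟩

variable {g : B6.Geometry} [Fintype X]

/-- THE η-PAIRING over the two-sided primitive matrix carriers (fine at `n′`, coarse at `n`) — NOT PRINTED data, as FILE 19's `bgPairingMBP₂`. [cite: King1986, p.664 (convention before Prop. 3.8)] -/
def bgPairingMC2₂ (blk : X → g.Site) (π : X' → X) (τ : J → X ≃ X) (τ' : J → X' ≃ X') (n n' : ℝ) (m : ℕ) (hL : g.L ≠ 0) :
    EtaPairing (opGeo g (X × ι) (liftBlk blk ι)) (fineGeo g (X' × ι) (liftBlk (blk ∘ π) ι) m) (coeffBgMC2₂ J ι τ n g.M) (coeffBgMC2₂ J ι τ' n' g.M) where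
  n := m
  k_eq := rfl
  L_eq := rfl
  M_eq := rfl
  eta_eq := (bgPairingMBP₂ J ι blk π τ τ' n n' m hL 0 0).eta_eq
  ι := fun y => y
  scale_ι := fun _ => rfl
  dist_ι := fun _ _ => rfl
  τ := fun lam => pull (liftMap π ι) lam
  suppIn_τ := fun _ _ h p hp => h (liftMap π ι p) hp
  supNorm_τ := (bgPairingMBP₂ J ι blk π τ τ' n n' m hL 0 0).supNorm_τ
  avg := avgM₁ (J ⊕ J) ι π
  avg_one := avgM₁_zero (J ⊕ J) ι π

/-- THE REALISED PAIRED INSTANCE of the two-sided matrix by-parts layer over the PRIMITIVE carriers. [cite: Balaban1985BackgroundPropagators, Thm 3.14 pp.426–427 (typing template)] -/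
def bgInstanceMC2₂ (blk : X → g.Site) (π : X' → X) (τ : J → X ≃ X) (τ' : J → X' ≃ X') (n n' : ℝ) (m : ℕ) (hL : g.L ≠ 0) : PairedInstance :=
  ⟨opGeo g (X × ι) (liftBlk blk ι), fineGeo g (X' × ι) (liftBlk (blk ∘ π) ι) m, coeffBgMC2₂ J ι τ n g.M, coeffBgMC2₂ J ι τ' n' g.M,
    bgPairingMC2₂ J ι blk π τ τ' n n' m hL⟩

end Carrier
section Ops

variable {X X' J ι : Type} [Fintype X] [Fintype X'] [Fintype J] [Fintype ι] [DecidableEq X] [DecidableEq X'] [DecidableEq J] [DecidableEq ι] {g : B6.Geometry}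
  (blk : X → g.Site) (π : X' → X)

/-- THE KERNEL FAMILY over the two-sided primitive matrix carrier: FILE 19's four entry operators `bgOpsMBP₂` read through the block norms of the product carriers.
[cite: Balaban1985BackgroundPropagators, (3.42) p.397 (shape)] -/
def bgFamilyMC2₂ (τ : J → X ≃ X) (τ' : J → X' ≃ X') (n n' : ℝ) (m : ℕ) (hL : g.L ≠ 0) (ν : J) (G D₃ : (X × ι → ℝ) →ₗ[ℝ] (X × ι → ℝ))
    (D : J ⊕ J → (X × ι → ℝ) →ₗ[ℝ] (X × ι → ℝ)) (G' D₃' : (X' × ι → ℝ) →ₗ[ℝ] (X' × ι → ℝ)) (D' : J ⊕ J → (X' × ι → ℝ) →ₗ[ℝ] (X' × ι → ℝ)) :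
    B9.KernelFamily (bgInstanceMC2₂ J ι blk π τ τ' n n' m hL).gc (bgInstanceMC2₂ J ι blk π τ τ' n n' m hL).Bf :=
  show B9.KernelFamily (opGeo g (X × ι) (liftBlk blk ι)) (coeffBgMC2₂ J ι τ' n' g.M) from
    opFamily (g := g) (B := coeffBgMC2₂ J ι τ' n' g.M) (liftBlk blk ι) (liftBlk (blk ∘ π) ι) (bgOpsMBP₂ π τ τ' n n' ν G D₃ D G' D₃' D')

end Ops
section Torus

variable {L : ℕ} [NeZero L]

variable (d) (ι : Type) [Fintype ι] [DecidableEq ι]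

/-- THE REALISED PAIRED INSTANCE at `(i, ν)` of the torus family of record over the two-sided PRIMITIVE matrix carriers; NO rate number.
[cite: Balaban1985BackgroundPropagators, Thm 3.14 pp.426–427 (typing template)] -/
def fgInstanceMC2₂ (hL : Odd L ∧ 1 < L) (i : TGIndex × Fin (d + 1)) : PairedInstance :=
  bgInstanceMC2₂ (Fin (d + 1)) ι (g := unitTorusGeo L i.1.k (TGIndex.Mn d hL i.1)) (blkFine L i.1.k (TGIndex.Mn d hL i.1)) (kingPrV L i.1.k i.1.m (TGIndex.Mn d hL i.1))
    (fun μ => bshiftEquiv (TGIndex.Mn d hL i.1) (L ^ i.1.k) μ) (fun μ => bshiftEquiv (TGIndex.Mn d hL i.1) (L ^ i.1.m * L ^ i.1.k) μ) ((L ^ i.1.k : ℕ) : ℝ)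
    ((L ^ i.1.m * L ^ i.1.k : ℕ) : ℝ) i.1.m (Nat.cast_ne_zero.mpr (NeZero.ne L))

/-- THE REALISED TWO-SIDED KERNEL FAMILY at `(i, ν)` over the primitive carrier (FILE 21's operators: `G = gOp ⊗ 1_ι`, `dPiecesM₂`, `D₃ = (ΔG) ⊗ 1_ι` at both spacings).
[cite: Balaban1985BackgroundPropagators, (3.42) p.397 (shape); Balaban1984PropagatorsII, (2.156) p.250] -/
def fgFamilyMC2₂ (hL : Odd L ∧ 1 < L) (b : ℝ) (i : TGIndex × Fin (d + 1)) : B9.KernelFamily (fgInstanceMC2₂ d ι hL i).gc (fgInstanceMC2₂ d ι hL i).Bf :=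
  bgFamilyMC2₂ (J := Fin (d + 1)) (ι := ι) (g := unitTorusGeo L i.1.k (TGIndex.Mn d hL i.1)) (blkFine L i.1.k (TGIndex.Mn d hL i.1))
    (kingPrV L i.1.k i.1.m (TGIndex.Mn d hL i.1)) (fun μ => bshiftEquiv (TGIndex.Mn d hL i.1) (L ^ i.1.k) μ)
    (fun μ => bshiftEquiv (TGIndex.Mn d hL i.1) (L ^ i.1.m * L ^ i.1.k) μ) ((L ^ i.1.k : ℕ) : ℝ) ((L ^ i.1.m * L ^ i.1.k : ℕ) : ℝ) i.1.m (Nat.cast_ne_zero.mpr (NeZero.ne L)) i.2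
    (tensorId ι (gOp (TGIndex.Mn d hL i.1) (L ^ i.1.k) b))
    (tensorId ι (symbOp (TGIndex.Mn d hL i.1) (L ^ i.1.k) (sLap (TGIndex.Mn d hL i.1) (L ^ i.1.k) ((L ^ i.1.k : ℕ) : ℝ)) ∘ₗ gOp (TGIndex.Mn d hL i.1) (L ^ i.1.k) b))
    (dPiecesM₂ d ι (TGIndex.Mn d hL i.1) (L ^ i.1.k) b)
    (tensorId ι (gOp (TGIndex.Mn d hL i.1) (L ^ i.1.m * L ^ i.1.k) b))
    (tensorId ι (symbOp (TGIndex.Mn d hL i.1) (L ^ i.1.m * L ^ i.1.k) (sLap (TGIndex.Mn d hL i.1) (L ^ i.1.m * L ^ i.1.k) ((L ^ i.1.m * L ^ i.1.k : ℕ) : ℝ)) ∘ₗ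
      gOp (TGIndex.Mn d hL i.1) (L ^ i.1.m * L ^ i.1.k) b))
    (dPiecesM₂ d ι (TGIndex.Mn d hL i.1) (L ^ i.1.m * L ^ i.1.k) b)

end Torus

/-! ## §3 Two-sided primitive-matrix ⟹ `coeffBgMBP₂` on the torus; the transfer; ★★★ the node theorem over the two-sided primitive matrix carrier -/

section Transfer

variable {L : ℕ} [NeZero L] (ι : Type) [Fintype ι] [DecidableEq ι]

omit [DecidableEq ι] in
/-- ★ **TWO-SIDED PRIMITIVE-MATRIX ⟹ `coeffBgMBP₂` AT LEVEL `4(2d+3)c`** on the torus family of record, for ANY rate exponent `γ ≤ 1` (`θ = (L^k)^{−γ} ≥ L^{−k}`): M1's pair over `J ⊕ J` and the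
five forward clauses by FILE 11 `reg_slim_of_C2` + FILE 9 `reg_BP_of_slim` on every entry of the forward family `(C′, A′)` and of the backward family `(C′, B′)` (the latter supplying the
backward values ∕ oscillations ∕ gradients), the backward translated fit by `abs_translatedFitFwd_le`, the backward untranslated derivative fit by ★ `abs_derivFit0_le`. [folklore] -/
theorem reg_MBP₂_of_MC2₂ (hL : Odd L ∧ 1 < L) {γ : ℝ} (hγ1 : γ ≤ 1) {c α₀ : ℝ} (i : TGIndex × Fin (d + 1))
    (hc : 0 ≤ c * (unitTorusGeo L i.1.k (TGIndex.Mn d hL i.1)).M * α₀) (U : (fgInstanceMC2₂ d ι hL i).Bf.Cfg) (hU : (fgInstanceMC2₂ d ι hL i).Bf.Reg335 c α₀ U) :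
    (fgInstanceM₂ d ι hL γ i).Bf.Reg335 (4 * ((2 * (d : ℝ) + 3) * c)) α₀ U := by
  have hL0 : 0 < L := by have := hL.2; omega
  have hL1 : (1 : ℝ) ≤ (L : ℝ) := by exact_mod_cast hL.2.le
  have hn : (0 : ℝ) < ((L ^ i.1.k : ℕ) : ℝ) := by exact_mod_cast pow_pos hL0 _
  have hnf : (0 : ℝ) < ((L ^ i.1.m * L ^ i.1.k : ℕ) : ℝ) := by positivity
  have hd0 : (0 : ℝ) ≤ d := Nat.cast_nonneg d
  have hθ : (((L ^ i.1.k : ℕ) : ℝ))⁻¹ ≤ ((L : ℝ) ^ i.1.k) ^ (-γ) := inv_pow_le_rate hL1 hγ1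
  have hθ0 : 0 ≤ ((L : ℝ) ^ i.1.k) ^ (-γ) := Real.rpow_nonneg (pow_nonneg (by positivity) _) _
  set A := c * (unitTorusGeo L i.1.k (TGIndex.Mn d hL i.1)).M * α₀ with hAdef
  have hc' : 0 ≤ (2 * (d : ℝ) + 3) * c * (unitTorusGeo L i.1.k (TGIndex.Mn d hL i.1)).M * α₀ := by
    rw [show (2 * (d : ℝ) + 3) * c * (unitTorusGeo L i.1.k (TGIndex.Mn d hL i.1)).M * α₀ = (2 * (d : ℝ) + 3) * A by rw [hAdef]; ring]; positivity
  -- entrywise: forward and backward families are `coeffBgBP`-regular at level `2(2d+3)c`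
  have hF : ∀ a e, (coeffBgBP (Fin (d + 1)) (kingPrV L i.1.k i.1.m (TGIndex.Mn d hL i.1)) (fun μ => bshiftEquiv (TGIndex.Mn d hL i.1) (L ^ i.1.k) μ)
      (fun μ => bshiftEquiv (TGIndex.Mn d hL i.1) (L ^ i.1.m * L ^ i.1.k) μ) ((L ^ i.1.k : ℕ) : ℝ) ((L ^ i.1.m * L ^ i.1.k : ℕ) : ℝ) (unitTorusGeo L i.1.k (TGIndex.Mn d hL i.1)).M
      (((L : ℝ) ^ i.1.k) ^ (-γ))).Reg335 (2 * ((2 * (d : ℝ) + 3) * c)) α₀ (entryCfg (Fin (d + 1)) ι (U.1, fun μ => U.2 (Sum.inl μ)) a e) := fun a e =>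
    reg_BP_of_slim hn (inv_pow_le_rate hL1 hγ1) hc' (fun μ x' => kingPrV_sub (TGIndex.Mn d hL i.1) L i.1.k i.1.m x' μ)
      (reg_slim_of_C2 hL hγ1 i hc (entryCfg (Fin (d + 1)) ι (U.1, fun μ => U.2 (Sum.inl μ)) a e) (entry_reg_C2_of_MC2₂ hU a e).1)
  have hB : ∀ a e, (coeffBgBP (Fin (d + 1)) (kingPrV L i.1.k i.1.m (TGIndex.Mn d hL i.1)) (fun μ => bshiftEquiv (TGIndex.Mn d hL i.1) (L ^ i.1.k) μ)
      (fun μ => bshiftEquiv (TGIndex.Mn d hL i.1) (L ^ i.1.m * L ^ i.1.k) μ) ((L ^ i.1.k : ℕ) : ℝ) ((L ^ i.1.m * L ^ i.1.k : ℕ) : ℝ) (unitTorusGeo L i.1.k (TGIndex.Mn d hL i.1)).M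
      (((L : ℝ) ^ i.1.k) ^ (-γ))).Reg335 (2 * ((2 * (d : ℝ) + 3) * c)) α₀ (entryCfg (Fin (d + 1)) ι (U.1, fun μ => U.2 (Sum.inr μ)) a e) := fun a e =>
    reg_BP_of_slim hn (inv_pow_le_rate hL1 hγ1) hc' (fun μ x' => kingPrV_sub (TGIndex.Mn d hL i.1) L i.1.k i.1.m x' μ)
      (reg_slim_of_C2 hL hγ1 i hc (entryCfg (Fin (d + 1)) ι (U.1, fun μ => U.2 (Sum.inr μ)) a e) (entry_reg_C2_of_MC2₂ hU a e).2)
  -- level bookkeeping: `2(2d+3)c ≤ 4(2d+3)c`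
  have hK : 2 * ((2 * (d : ℝ) + 3) * c) * (unitTorusGeo L i.1.k (TGIndex.Mn d hL i.1)).M * α₀ ≤ 4 * ((2 * (d : ℝ) + 3) * c) * (unitTorusGeo L i.1.k (TGIndex.Mn d hL i.1)).M * α₀ := by
    have : 0 ≤ 2 * ((2 * (d : ℝ) + 3) * c) * (unitTorusGeo L i.1.k (TGIndex.Mn d hL i.1)).M * α₀ := by
      rw [show 2 * ((2 * (d : ℝ) + 3) * c) * (unitTorusGeo L i.1.k (TGIndex.Mn d hL i.1)).M * α₀ = 2 * (2 * (d : ℝ) + 3) * A by rw [hAdef]; ring]; positivity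
    nlinarith
  have hKθ : 2 * ((2 * (d : ℝ) + 3) * c) * (unitTorusGeo L i.1.k (TGIndex.Mn d hL i.1)).M * α₀ * ((L : ℝ) ^ i.1.k) ^ (-γ) ≤
      4 * ((2 * (d : ℝ) + 3) * c) * (unitTorusGeo L i.1.k (TGIndex.Mn d hL i.1)).M * α₀ * ((L : ℝ) ^ i.1.k) ^ (-γ) := mul_le_mul_of_nonneg_right hK hθ0
  -- the backward translated fit and the backward untranslated derivative fit, from the primitive letters
  have hlevθ : ∀ {t s : ℝ}, t ≤ s * A / ((L ^ i.1.k : ℕ) : ℝ) → s ≤ 4 * (2 * (d : ℝ) + 3) → 0 ≤ s →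
      t ≤ 4 * ((2 * (d : ℝ) + 3) * c) * (unitTorusGeo L i.1.k (TGIndex.Mn d hL i.1)).M * α₀ * ((L : ℝ) ^ i.1.k) ^ (-γ) := fun {t s} ht hs hs0 => by
    refine ht.trans ?_
    rw [div_eq_mul_inv, show 4 * ((2 * (d : ℝ) + 3) * c) * (unitTorusGeo L i.1.k (TGIndex.Mn d hL i.1)).M * α₀ = (4 * (2 * (d : ℝ) + 3)) * A by rw [hAdef]; ring]
    exact mul_le_mul (mul_le_mul_of_nonneg_right hs hc) hθ (inv_pos.mpr hn).le (mul_nonneg (by positivity) hc)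
  have hnfc : ((L ^ i.1.m * L ^ i.1.k : ℕ) : ℝ) = ((L ^ i.1.m : ℕ) : ℝ) * ((L ^ i.1.k : ℕ) : ℝ) := by push_cast; ring
  have hoscK : (((2 * ((d + 1) * (L ^ i.1.m - 1)) : ℕ) : ℝ)) * (A / ((L ^ i.1.m * L ^ i.1.k : ℕ) : ℝ)) ≤ (2 * (d : ℝ) + 3) * A / ((L ^ i.1.k : ℕ) : ℝ) := by
    have h1 : ((L ^ i.1.m - 1 : ℕ) : ℝ) ≤ ((L ^ i.1.m : ℕ) : ℝ) := by exact_mod_cast Nat.sub_le _ _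
    have hsub : (((2 * ((d + 1) * (L ^ i.1.m - 1)) : ℕ) : ℝ)) ≤ (2 * (d : ℝ) + 3) * ((L ^ i.1.m : ℕ) : ℝ) := by
      push_cast at h1 ⊢
      have hLm : (0 : ℝ) ≤ (L : ℝ) ^ i.1.m := by positivity
      nlinarith
    calc (((2 * ((d + 1) * (L ^ i.1.m - 1)) : ℕ) : ℝ)) * (A / ((L ^ i.1.m * L ^ i.1.k : ℕ) : ℝ))
        ≤ (2 * (d : ℝ) + 3) * ((L ^ i.1.m : ℕ) : ℝ) * (A / ((L ^ i.1.m * L ^ i.1.k : ℕ) : ℝ)) := mul_le_mul_of_nonneg_right hsub (div_nonneg hc hnf.le)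
      _ = (2 * (d : ℝ) + 3) * A / ((L ^ i.1.k : ℕ) : ℝ) := by rw [hnfc]; field_simp
  obtain ⟨⟨hv1, hv2⟩, ⟨hq1, hq2⟩, -, hs2⟩ := hU
  refine ⟨⟨⟨fun x' a e => ((hF a e).1.1.1 x').trans hK, fun ĵ x' a e => ?_⟩, fun a e => ((hF a e).1.2.1).mono fun _ => hKθ, fun ĵ a e => ?_⟩,
    ⟨fun μ x a e => ?_, fun μ x' a e => ?_, fun μ x' a e => ((hF a e).2.2.2.1 μ x').trans hKθ, fun μ x' a e => ?_, fun μ x a e => ?_⟩,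
    fun μ x a e => ?_, fun μ x' a e => ?_, fun μ x' a e => ?_, fun μ x' a e => ?_⟩
  · cases ĵ with
    | inl μ => exact ((hF a e).1.1.2 μ x').trans hK
    | inr μ => exact ((hB a e).1.1.2 μ x').trans hK
  · cases ĵ with
    | inl μ => exact ((hF a e).1.2.2 μ).mono fun _ => hKθ
    | inr μ => exact ((hB a e).1.2.2 μ).mono fun _ => hKθ
  · rw [fgradMat_apply, avgM₁_snd_entry]; exact ((hF a e).2.1 μ x).trans hK
  · rw [fgradMat_apply]; exact ((hF a e).2.2.1 μ x').trans hK
  · rw [fgradMat_apply, fgradMat_apply, avgM₁_snd_entry]; exact ((hF a e).2.2.2.2.1 μ x').trans hKθ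
  · exact ((hF a e).2.2.2.2.2 μ x).trans hKθ
  · rw [fgradMat_apply, avgM₁_snd_entry]; exact ((hB a e).2.1 μ x).trans hK
  · rw [fgradMat_apply]; exact ((hB a e).2.2.1 μ x').trans hK
  · -- backward translated fit along `+e`: block oscillation (from the fine gradients) + coarse one-step oscillation
    have hosc := fibreOsc_of_fgrad L i.1.k i.1.m (TGIndex.Mn d hL i.1) hnf (f := fun y => U.2 (Sum.inr μ) y a e) (fun κ z => hq2 (Sum.inr μ) κ z a e)
    have hgrad := fun x => abs_fgrad_blockAvg_le L i.1.k i.1.m (TGIndex.Mn d hL i.1) hc μ (f := fun y => U.2 (Sum.inr μ) y a e) (fun z => hq2 (Sum.inr μ) μ z a e) x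
    have h1 := abs_translatedFitFwd_le L i.1.k i.1.m (TGIndex.Mn d hL i.1) μ hc hosc hgrad x'
    refine hlevθ (s := 2 * (d : ℝ) + 4) (h1.trans ?_) (by nlinarith) (by positivity)
    rw [show (2 * (d : ℝ) + 4) * A / ((L ^ i.1.k : ℕ) : ℝ) = (2 * (d : ℝ) + 3) * A / ((L ^ i.1.k : ℕ) : ℝ) + A / ((L ^ i.1.k : ℕ) : ℝ) by ring]
    exact add_le_add hoscK le_rfl
  · -- backward untranslated derivative fit
    have h1 := abs_derivFit0_le L i.1.k i.1.m (TGIndex.Mn d hL i.1) hc μ (f := fun y => U.2 (Sum.inr μ) y a e) (fun κ z => hs2 μ κ z a e) x'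
    rw [fgradMat_apply, fgradMat_apply, avgM₁_snd_entry]
    exact hlevθ (s := 2 * (d : ℝ) + 5) h1 (by nlinarith) (by positivity)

variable (d)

/-- ★★ **TRANSFER**: `NE2PlusOperator (4(2d+3)c₃₅)` for FILE 21's family over `coeffBgMBP₂` (rate exponent `γ ≤ 1`) gives `NE2PlusOperator c₃₅` over the two-sided PRIMITIVE matrix carrier —
same predicate (same geometry and entry operators), larger admitted class (`reg_MBP₂_of_MC2₂`). [cite: Balaban1985BackgroundPropagators, Thm 3.1 p.397 (quantifier template)] -/
theorem ne2PlusOperator_fullGM₂_C2_of_MBP₂ [Nonempty ι] (hL : Odd L ∧ 1 < L) {b γ : ℝ} (hγ1 : γ ≤ 1) {c35 : ℝ} (hc35 : 0 ≤ c35)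
    (h : NE2PlusOperator (4 * ((2 * (d : ℝ) + 3) * c35)) (fgInstanceM₂ d ι hL γ) (fgFamilyM₂ d ι hL b γ)) :
    NE2PlusOperator c35 (fgInstanceMC2₂ d ι hL) (fgFamilyMC2₂ d ι hL b) := by
  obtain ⟨M₅, δ₀, a₀, B₀, γ', hM₅, hδ₀, ha₀, hB₀, hγ', H⟩ := h
  refine ⟨M₅, δ₀, a₀, B₀, γ', hM₅, hδ₀, ha₀, hB₀, hγ', fun i hM α₀ hα₀ hMa U hU => ?_⟩
  have hMpos : 0 < (fgInstanceMC2₂ d ι hL i).gf.M := hM₅.trans_le hM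
  have hc : 0 ≤ c35 * (unitTorusGeo L i.1.k (TGIndex.Mn d hL i.1)).M * α₀ := mul_nonneg (mul_nonneg hc35 hMpos.le) hα₀.le
  exact H i hM α₀ hα₀ hMa U (reg_MBP₂_of_MC2₂ ι hL hγ1 i hc U hU)

variable [Nonempty ι]

/-- ★★★ **`T4EtaRate.NE2PlusOperator` BY NAME, NO DISPLAYED BINDER, over the TWO-SIDED PRIMITIVE MATRIX (3.35)–(3.36) carrier**: Bałaban's FULL `U ≡ 1` Landau-gauge propagator acting
componentwise on `𝔤 ≅ ℝ^ι`-valued 1-forms (`gOp ⊗ 1_𝔤`, [B6] (2.156)) on the torus family of record, dressed by a LIVE two-sided non-abelian first-order background `M_C + Σ_μ[M_{A_μ}∇_μ +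
M_{B_μ}∇⁻_μ]` (the shape of Bałaban's (3.52) `V′₁(A)` in coordinates: BOTH bond orientations) whose regularity is ONLY the entrywise sup letters on `C′`, `A′_μ`, `B′_μ`, their first quotients
and the second quotients of `A′_μ`, `B′_μ` (`≤ c₃₅Mα₀`); all four (3.42) entries constructed, entry 2 by parts, `d ≥ 1`, odd `L ≥ 3`, `b > 0`, `c₃₅ > 0`, `ι` nonempty; the rate exponent
(`1∕(8(d+1))`) is PRODUCED inside the `∃`.  FILE 21 ★★★ at `4(2d+3)c₃₅` through the transfer.  MODEL-LEVEL species (free matrix coefficients, entrywise-linearised transport), GENUINE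
propagator; NO (3.44) mixed letter. [cite: Balaban1985BackgroundPropagators, Thm 3.1 p.397 (quantifier template); (3.35)–(3.36) p.396, (3.42) p.397, (3.52) p.400 (shapes); Balaban1984PropagatorsII, (2.156) p.250] -/
theorem ne2PlusOperator_fullGM₂_C2 (hd1 : 1 ≤ d) (hLodd : Odd L) (hL2 : 2 ≤ L) (hL : Odd L ∧ 1 < L) {b : ℝ} (hb : 0 < b) (c35 : ℝ) (hc35 : 0 < c35) :
    NE2PlusOperator c35 (fgInstanceMC2₂ d ι hL) (fgFamilyMC2₂ d ι hL b) := by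
  have hd0 : (0 : ℝ) ≤ d := Nat.cast_nonneg d
  have hγ1 : 1 / (8 * ((d : ℝ) + 1)) ≤ 1 := by
    rw [div_le_one (by positivity)]
    linarith
  exact ne2PlusOperator_fullGM₂_C2_of_MBP₂ d ι hL hγ1 hc35.le
    (ne2PlusOperator_fullGM₂_byParts d ι hd1 hLodd hL2 hL hb (4 * ((2 * (d : ℝ) + 3) * c35)) (by positivity))

/-- The four-dimensional two-sided instance (`d + 1 = 4`). [cite: Balaban1985BackgroundPropagators, Thm 3.1 p.397 (quantifier template)] -/
theorem ne2PlusOperator_fullGM₂_C2_dim4 (hLodd : Odd L) (hL2 : 2 ≤ L) (hL : Odd L ∧ 1 < L) {b : ℝ} (hb : 0 < b) (c35 : ℝ) (hc35 : 0 < c35) :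
    NE2PlusOperator c35 (fgInstanceMC2₂ 3 ι hL) (fgFamilyMC2₂ 3 ι hL b) :=
  ne2PlusOperator_fullGM₂_C2 3 ι (by norm_num) hLodd hL2 hL hb c35 hc35

end Transfer

end Summit.QuantumFields.YangMills.BalabanUVNodes.N15.BackgroundLayer

end
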